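/-
Copyright (c) 2026 the pub-hodgecm-mathlib formalisation cell (harness21).  Prover seat hodgecm-mathlib-F0P3a-p07 (g19): ROAD «HC-D» (holder F0P2-p01 (g23)),
brick D5(iv)+GLOBAL, sequel «DESCENT» (local inputs stated on `↥𝔲`), 2026-09-02.
-/
import Summits.HodgeConjecture.HodgeConjecture.Theorems.F0P3cStCharTSHCDLieGlobal   -- (this seat) GLOBAL: `exists_centreSplitting`, `…_of_local`, `measurable_etaInv_subtype`
import HarnessLib

/-!
# ROAD «HC-D», brick D5(iv)+GLOBAL — sequel: pointwise descent `↥𝔲 ⇒ ↥𝔲₀` and GLOBAL with the local inputs stated on `↥𝔲`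

Cell `pub/hodgecm-mathlib`, crux H413 = `stmt-HodgeConjecture-24833` (lane `--supports … --as helper`), route HCCMUnconditional; ROAD «HC-D» (holder F0P2-p01 (g23)).
THEOREMS ONLY; ★-only imports.  HONEST LABEL: HC_CM is proved only modulo the 7 printed citations (2 remaining named inputs: hLiu418 = `stmt-HodgeConjecture-24832`,
h413 = `stmt-HodgeConjecture-24833`) until rung 0 closes; count-neutral (pays no organ, opens no road).

WHY.  The D5 hands' slices live in `𝔲`, so their local theorems come out naturally as «`∃ U ∈ 𝓝 X₀` in `↥𝔲`, `∫⁻_U ηι ∂μ < ∞`» for an additive Haar measure `μ` on `↥𝔲`,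
while GLOBAL's case split runs on the trace-zero part `↥𝔲₀` (RULING R3; ref5 R-752 (2)).  This sequel closes the seam once and for all: along the centre splitting
`e (z, Y) = z • 1 + Y` of ★ `exists_centreSplitting`, ★ (G-FUB) «LOCAL FINITENESS DESCENDS» at `z = 0` carries local finiteness at `Y₀` viewed in `↥𝔲` down to `Y₀ ∈ ↥𝔲₀`
(any Haar measures, constants absorbed), and GLOBAL follows from inputs on `↥𝔲` — `hreg` at regular points, `hnonreg` at NON-CENTRAL non-regular points (`∀ a, X₀ ≠ a • 1`
replaces `X₀ ≠ 0`: a trace-zero central element vanishes because `(3 : K) ≠ 0`).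

## References
* [HarishChandra1970] Harish-Chandra (notes by G. van Dijk), *Harmonic Analysis on Reductive p-adic Groups*, LNM 162 (1970), Part VII §1 Thm. 15.
* [Folland1999] G. B. Folland, *Real Analysis* (2nd ed., 1999), §11.1 Thm. 11.9 (uniqueness of Haar measure).
-/

set_option autoImplicit false
-- the mandated namespace has the single-problem summit's repeated segment (`HodgeConjecture.HodgeConjecture`)
set_option linter.dupNamespace false

noncomputable section

open MeasureTheory MeasureTheory.Measure Filter Topology Set Matrix Finset
open scoped ENNReal NNReal Topology Matrix
open Literature.NumberTheory.GaloisRepresentations Literature.NumberTheory.Automorphic Literature.MeasureTheory.Group Literature.MeasureTheory.Integral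
open Literature.LinearAlgebra.Matrix
open Summit.HodgeConjecture.HodgeConjecture.Cruxes.H413.F0P3cStCharTSHCDLieGlobal

namespace Summit.HodgeConjecture.HodgeConjecture.Cruxes.H413.F0P3cStCharTSHCDLieGlobalDescent

variable {K : Type*} [Field K] [ValuativeRel K] [TopologicalSpace K] [IsNonarchimedeanLocalField K] {σ : K →+* K}

/-! ## §1 Pointwise descent along the centre splitting -/

/-- **POINTWISE DESCENT `↥𝔲 ⇒ ↥𝔲₀`**: if `ηι` is locally `∫⁻`-finite (w.r.t. ANY Haar `μ` on `↥𝔲`) near a trace-zero `Y₀` viewed in `↥𝔲`, then it is locally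
`∫⁻`-finite near `Y₀` in `↥𝔲₀` (w.r.t. ANY Haar `μ₀`) — ★ (G-FUB) «LOCAL FINITENESS DESCENDS» along the centre splitting at `z = 0`.  This lets D5(i)∕(ii)∕(iii) hands state their
local theorems on `↥𝔲` (where their slices live) and still dock into GLOBAL. [cite: HarishChandra1970, Part VII §1 Thm. 15] [cite: Folland1999, §11.1 Thm. 11.9] -/
theorem exists_nhds_setLIntegral_etaInv_lt_top_traceZero_of_lie (hσc : Continuous σ)
    {J : Matrix (Fin 3) (Fin 3) K} (hJd : IsUnit J.det) (h3 : (3 : K) ≠ 0)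
    (𝔲 : AddSubgroup (Matrix (Fin 3) (Fin 3) K)) (h𝔲 : ∀ X, X ∈ 𝔲 ↔ (X.map σ)ᵀ * J + J * X = 0)
    (𝔲₀ : AddSubgroup (Matrix (Fin 3) (Fin 3) K)) (h𝔲₀ : ∀ X, X ∈ 𝔲₀ ↔ (X.map σ)ᵀ * J + J * X = 0 ∧ Matrix.trace X = 0)
    [MeasurableSpace ↥𝔲₀] [BorelSpace ↥𝔲₀] (μ₀ : Measure ↥𝔲₀) [μ₀.IsAddHaarMeasure]
    [MeasurableSpace ↥𝔲] [BorelSpace ↥𝔲] (μ : Measure ↥𝔲) [μ.IsAddHaarMeasure]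
    (Y₀ : ↥𝔲₀)
    (hY : ∃ U ∈ 𝓝 (⟨(Y₀ : Matrix (Fin 3) (Fin 3) K), (h𝔲 _).2 ((h𝔲₀ _).1 Y₀.2).1⟩ : ↥𝔲),
      ∫⁻ X in U, ((NNReal.sqrt (NNReal.sqrt (IsNonarchimedeanLocalField.normAbs K (Matrix.charpoly (X : Matrix (Fin 3) (Fin 3) K)).discr)) : ℝ≥0∞))⁻¹ ∂μ < ∞) :
    ∃ U ∈ 𝓝 Y₀,
      ∫⁻ X in U, ((NNReal.sqrt (NNReal.sqrt (IsNonarchimedeanLocalField.normAbs K (Matrix.charpoly (X : Matrix (Fin 3) (Fin 3) K)).discr)) : ℝ≥0∞))⁻¹ ∂μ₀ < ∞ := by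
  classical
  haveI : T2Space K := (IsNonarchimedeanLocalField.isLocalField K).toT2Space
  haveI := secondCountableTopology_localField K
  set Z : AddSubgroup K := ((σ : K →+* K).toAddMonoidHom + AddMonoidHom.id K).ker with hZ
  have memZ : ∀ z : K, z ∈ Z ↔ σ z = -z := fun z => mem_ker_add_id_iff σ z
  have hZc : IsClosed (Z : Set K) := by
    have : (Z : Set K) = {z | σ z + z = 0} := by
      ext z; rw [SetLike.mem_coe, memZ, Set.mem_setOf_eq, add_eq_zero_iff_eq_neg]
    rw [this]
    exact isClosed_eq (hσc.add continuous_id) continuous_const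
  letI : MeasurableSpace ↥Z := borel ↥Z
  haveI : BorelSpace ↥Z := ⟨rfl⟩
  haveI : LocallyCompactSpace ↥Z := hZc.locallyCompactSpace
  haveI : SecondCountableTopology ↥Z := TopologicalSpace.Subtype.secondCountableTopology _
  have hlin : Continuous fun X : Matrix (Fin 3) (Fin 3) K => (X.map σ)ᵀ * J + J * X := by
    have hmap : Continuous fun X : Matrix (Fin 3) (Fin 3) K => X.map σ := continuous_id.matrix_map hσc
    exact (hmap.matrix_transpose.matrix_mul continuous_const).add (continuous_const.matrix_mul continuous_id)
  have h𝔲c : IsClosed (𝔲 : Set (Matrix (Fin 3) (Fin 3) K)) := by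
    have : (𝔲 : Set (Matrix (Fin 3) (Fin 3) K)) = (fun X : Matrix (Fin 3) (Fin 3) K => (X.map σ)ᵀ * J + J * X) ⁻¹' {0} := by
      ext X; rw [SetLike.mem_coe, h𝔲]; rfl
    rw [this]; exact isClosed_singleton.preimage hlin
  have h𝔲₀c : IsClosed (𝔲₀ : Set (Matrix (Fin 3) (Fin 3) K)) := by
    have : (𝔲₀ : Set (Matrix (Fin 3) (Fin 3) K)) =
        (fun X : Matrix (Fin 3) (Fin 3) K => (X.map σ)ᵀ * J + J * X) ⁻¹' {0} ∩ (fun X : Matrix (Fin 3) (Fin 3) K => Matrix.trace X) ⁻¹' {0} := by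
      ext X; rw [SetLike.mem_coe, h𝔲₀]; rfl
    rw [this]
    exact (isClosed_singleton.preimage hlin).inter (isClosed_singleton.preimage (continuous_id.matrix_trace))
  haveI : LocallyCompactSpace (Matrix (Fin 3) (Fin 3) K) := inferInstanceAs (LocallyCompactSpace (Fin 3 → Fin 3 → K))
  haveI : SecondCountableTopology (Matrix (Fin 3) (Fin 3) K) := inferInstanceAs (SecondCountableTopology (Fin 3 → Fin 3 → K))
  haveI : LocallyCompactSpace ↥𝔲 := h𝔲c.locallyCompactSpace
  haveI : LocallyCompactSpace ↥𝔲₀ := h𝔲₀c.locallyCompactSpace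
  haveI : SecondCountableTopology ↥𝔲 := TopologicalSpace.Subtype.secondCountableTopology _
  haveI : SecondCountableTopology ↥𝔲₀ := TopologicalSpace.Subtype.secondCountableTopology _
  obtain ⟨e, he⟩ := exists_centreSplitting hJd h3 𝔲 h𝔲 𝔲₀ h𝔲₀
  set f : ↥𝔲 → ℝ≥0∞ := fun X =>
    ((NNReal.sqrt (NNReal.sqrt (IsNonarchimedeanLocalField.normAbs K (Matrix.charpoly (X : Matrix (Fin 3) (Fin 3) K)).discr)) : ℝ≥0∞))⁻¹ with hfdef
  set g : ↥𝔲₀ → ℝ≥0∞ := fun Y =>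
    ((NNReal.sqrt (NNReal.sqrt (IsNonarchimedeanLocalField.normAbs K (Matrix.charpoly (Y : Matrix (Fin 3) (Fin 3) K)).discr)) : ℝ≥0∞))⁻¹ with hgdef
  have hfg : ∀ (z : ↥Z) (Y : ↥𝔲₀), f (e (z, Y)) = g Y := by
    intro z Y
    simp only [hfdef, hgdef]
    have hd : (Matrix.charpoly ((e (z, Y) : ↥𝔲) : Matrix (Fin 3) (Fin 3) K)).discr = (Matrix.charpoly (Y : Matrix (Fin 3) (Fin 3) K)).discr := by
      rw [he, add_comm]; exact discr_add_smul_one_fin_three _ _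
    rw [hd]
  have hg : Measurable g := measurable_etaInv_subtype 𝔲₀
  -- `e (0, Y₀)` is `Y₀` viewed in `𝔲`
  have he0 : e (0, Y₀) = ⟨(Y₀ : Matrix (Fin 3) (Fin 3) K), (h𝔲 _).2 ((h𝔲₀ _).1 Y₀.2).1⟩ := by
    apply Subtype.ext
    rw [he]
    change ((0 : K)) • (1 : Matrix (Fin 3) (Fin 3) K) + (Y₀ : Matrix (Fin 3) (Fin 3) K) = (Y₀ : Matrix (Fin 3) (Fin 3) K)
    rw [zero_smul, zero_add]
  refine exists_nhds_setLIntegral_lt_top_of_prod_symm e μ₀ μ (Measure.addHaar : Measure ↥Z) hg hfg (z := 0) ?_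
  rw [he0]
  exact hY


/-! ## §2 GLOBAL with the local inputs stated on `↥𝔲` -/

/-- **GLOBAL ON `↥𝔲`, LOCAL INPUTS STATED ON `↥𝔲`** (the variant for hands whose slices live in `𝔲`, ref5 R-752 (2)): `hreg` at REGULAR points of `↥𝔲`, `hnonreg` at
NON-CENTRAL non-regular points of `↥𝔲` (`∀ a, X₀ ≠ a • 1` replaces `X₀ ≠ 0`: a trace-zero central element is `0` since `(3 : K) ≠ 0`), both against ANY Haar `μ` on `↥𝔲`; they
descend to `↥𝔲₀` by `exists_nhds_setLIntegral_etaInv_lt_top_traceZero_of_lie`, and §4 concludes. [cite: HarishChandra1970, Part VII §1 Thm. 15] [cite: Folland1999, §11.1 Thm. 11.9] -/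
theorem forall_exists_nhds_setLIntegral_etaInv_lt_top_of_local_lie
    {σ : K →+* K} (hσc : Continuous σ)
    {J : Matrix (Fin 3) (Fin 3) K} (hJd : IsUnit J.det) (h3 : (3 : K) ≠ 0)
    (𝔲 : AddSubgroup (Matrix (Fin 3) (Fin 3) K)) (h𝔲 : ∀ X, X ∈ 𝔲 ↔ (X.map σ)ᵀ * J + J * X = 0)
    (𝔲₀ : AddSubgroup (Matrix (Fin 3) (Fin 3) K)) (h𝔲₀ : ∀ X, X ∈ 𝔲₀ ↔ (X.map σ)ᵀ * J + J * X = 0 ∧ Matrix.trace X = 0)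
    [MeasurableSpace ↥𝔲₀] [BorelSpace ↥𝔲₀] (μ₀ : Measure ↥𝔲₀) [μ₀.IsAddHaarMeasure]
    [MeasurableSpace ↥𝔲] [BorelSpace ↥𝔲] (μ : Measure ↥𝔲) [μ.IsAddHaarMeasure]
    {F' : Type*} [Field F'] [ValuativeRel F'] [TopologicalSpace F'] [IsNonarchimedeanLocalField F']
    (ι : F' →+* K) (hιn : ∀ x : F', IsNonarchimedeanLocalField.normAbs K (ι x) = IsNonarchimedeanLocalField.normAbs F' x ^ 2)
    (Φ₀ : (Fin 8 → F') ≃ₜ+ ↥𝔲₀)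
    (hΦ₀ : ∀ (l : F') (a : Fin 8 → F'), ((Φ₀ (l • a) : ↥𝔲₀) : Matrix (Fin 3) (Fin 3) K) = ι l • ((Φ₀ a : ↥𝔲₀) : Matrix (Fin 3) (Fin 3) K))
    (hreg : ∀ X₀ : ↥𝔲, LinearIndependent K ![(1 : Matrix (Fin 3) (Fin 3) K), (X₀ : Matrix (Fin 3) (Fin 3) K), (X₀ : Matrix (Fin 3) (Fin 3) K) ^ 2] →
      ∃ U ∈ 𝓝 X₀, ∫⁻ X in U, ((NNReal.sqrt (NNReal.sqrt (IsNonarchimedeanLocalField.normAbs K (Matrix.charpoly (X : Matrix (Fin 3) (Fin 3) K)).discr)) : ℝ≥0∞))⁻¹ ∂μ < ∞)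
    (hnonreg : ∀ X₀ : ↥𝔲, (∀ a : K, (X₀ : Matrix (Fin 3) (Fin 3) K) ≠ a • 1) →
      ¬ LinearIndependent K ![(1 : Matrix (Fin 3) (Fin 3) K), (X₀ : Matrix (Fin 3) (Fin 3) K), (X₀ : Matrix (Fin 3) (Fin 3) K) ^ 2] →
      ∃ U ∈ 𝓝 X₀, ∫⁻ X in U, ((NNReal.sqrt (NNReal.sqrt (IsNonarchimedeanLocalField.normAbs K (Matrix.charpoly (X : Matrix (Fin 3) (Fin 3) K)).discr)) : ℝ≥0∞))⁻¹ ∂μ < ∞) :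
    ∀ X₀ : ↥𝔲, ∃ U ∈ 𝓝 X₀,
      ∫⁻ X in U, ((NNReal.sqrt (NNReal.sqrt (IsNonarchimedeanLocalField.normAbs K (Matrix.charpoly (X : Matrix (Fin 3) (Fin 3) K)).discr)) : ℝ≥0∞))⁻¹ ∂μ < ∞ := by
  refine forall_exists_nhds_setLIntegral_etaInv_lt_top_of_local hσc hJd h3 𝔲 h𝔲 𝔲₀ h𝔲₀ μ₀ μ ι hιn Φ₀ hΦ₀ ?_ ?_
  · intro Y₀ hli
    exact exists_nhds_setLIntegral_etaInv_lt_top_traceZero_of_lie hσc hJd h3 𝔲 h𝔲 𝔲₀ h𝔲₀ μ₀ μ Y₀ (hreg _ hli)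
  · intro Y₀ hY0 hli
    refine exists_nhds_setLIntegral_etaInv_lt_top_traceZero_of_lie hσc hJd h3 𝔲 h𝔲 𝔲₀ h𝔲₀ μ₀ μ Y₀ (hnonreg _ ?_ hli)
    intro a ha
    apply hY0
    apply Subtype.ext
    have htr : Matrix.trace (Y₀ : Matrix (Fin 3) (Fin 3) K) = 0 := ((h𝔲₀ _).1 Y₀.2).2
    have ha0 : a = 0 := by
      have h := htr
      rw [show (Y₀ : Matrix (Fin 3) (Fin 3) K) = a • 1 from ha, Matrix.trace_smul, Matrix.trace_one, Fintype.card_fin, smul_eq_mul] at h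
      push_cast at h
      rcases mul_eq_zero.1 h with h | h
      · exact h
      · exact absurd h h3
    change (Y₀ : Matrix (Fin 3) (Fin 3) K) = 0
    rw [show (Y₀ : Matrix (Fin 3) (Fin 3) K) = a • 1 from ha, ha0, zero_smul]

end Summit.HodgeConjecture.HodgeConjecture.Cruxes.H413.F0P3cStCharTSHCDLieGlobalDescent

end
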